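import Mathlib
import Summits.Ventures.PercRepro2.Defs
import Summits.Ventures.PercRepro2.Harris
import Summits.Ventures.PercRepro2.Events
import Summits.Ventures.PercRepro2.TReduction
import Summits.Ventures.PercRepro2.TReductionBase
import Summits.Ventures.PercRepro2.AntipodalKleitman

/-!
# The three-event inequality (T) for a principal edge event (blind cell PercRepro2, mine-a g48)

For a product Bernoulli measure on the configurations `Config E = E → Bool`, a finite set `S` of
edges and two increasing events `U e` (`IsUpperSet` in the product order), the *principal edge
event* `Q = openOn S = {every edge of S is open}` satisfies the lane's three-event inequality

  `P(Q ∩ U) P(e) + P(Q ∩ e) P(U) ≤ P(Q ∩ U ∩ e) + P(Q) P(U ∩ e)`   (`t_principal`).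

Nothing about a graph enters: `U` and `e` are arbitrary increasing events (the cluster events
`{C(s) ∈ 𝓤}` of an up-set `𝓤` of vertex sets are the case of record, `t_principal_cluster`).
It is the `k = 1` member of the lane's union structure — the hit event `{h ∈ C(s)}` of a graph is
the union over the `s`–`h` paths `P` of the principal events `openOn P` — and the case of a
single `s`–`h` path in the graph; for one edge it is an easy Harris consequence, for `#S ≥ 2` it
is not (the measure conditioned on «`S` not all open» is not a product measure).

Proof: by the lane's reduction (`TReduction.tform_nonneg_of_base`) it suffices that every
antipodal base case `K_D(a) ≥ 0`; at a base case the sum runs over the 2-colourings `τ ⊆ D`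
(`τ` = the edges of `D` closed in the first copy, `D ∖ τ` those closed in the second), with the
pinned-closed set `F` off `D`.  The first-copy indicator of `Q` is `[S ∩ (τ ∪ F) = ∅]`: if `S`
meets `F` every term vanishes, otherwise the sum is over `τ ⊆ D ∖ S` and the second copy is
closed on `(D ∖ S ∖ τ) ∪ (F ∪ (D ∩ S))` — Kleitman's comparable antipodal form with the pinned
sets `F ⊆ F ∪ (D ∩ S)` (`AntipodalKleitman.antipodal_comparable_nonneg`, Mathlib only) for the
antitone `{0,1}`-valued functions «`U` at the configuration closed on `Z`».  No instance, no
notation.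
-/

namespace Summit.Ventures.PercRepro2

namespace TPrincipal

open Finset TReduction AntipodalKleitman

section Closed

variable {E : Type*} [Fintype E] [DecidableEq E]

/-- The principal edge event: every edge of `S` is open. -/
def openOn (S : Finset E) : Set (Config E) := {ω | ∀ x ∈ S, ω x = true}

omit [Fintype E] [DecidableEq E] in
/-- Membership in `openOn`. -/
lemma mem_openOn {S : Finset E} {ω : Config E} : ω ∈ openOn S ↔ ∀ x ∈ S, ω x = true := Iff.rfl

/-- The configuration closed exactly on `Z`. -/
def cfgOfClosed (Z : Finset E) : Config E := fun x => decide (x ∉ Z)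

/-- The closed set of a configuration. -/
def closedSet (ω : Config E) : Finset E := univ.filter fun x => ω x = false

omit [DecidableEq E] in
/-- Membership in the closed set. -/
@[simp] lemma mem_closedSet {ω : Config E} {x : E} : x ∈ closedSet ω ↔ ω x = false := by
  simp [closedSet]

omit [Fintype E] in
/-- `cfgOfClosed` at an edge. -/
lemma cfgOfClosed_apply (Z : Finset E) (x : E) : cfgOfClosed Z x = decide (x ∉ Z) := rfl

/-- A configuration is the one closed on its closed set. -/
lemma cfgOfClosed_closedSet (ω : Config E) : cfgOfClosed (closedSet ω) = ω := by
  funext x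
  simp only [cfgOfClosed_apply, mem_closedSet]
  cases ω x <;> simp

/-- The closed set of `cfgOfClosed Z` is `Z`. -/
lemma closedSet_cfgOfClosed (Z : Finset E) : closedSet (cfgOfClosed Z) = Z := by
  ext x
  simp [cfgOfClosed_apply]

omit [Fintype E] in
/-- A larger closed set gives a smaller configuration. -/
lemma cfgOfClosed_le_of_subset {Z Z' : Finset E} (h : Z ⊆ Z') : cfgOfClosed Z' ≤ cfgOfClosed Z := by
  intro x
  simp only [cfgOfClosed_apply]
  by_cases hx : x ∈ Z
  · simp [hx, h hx]
  · simp [hx]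

open Classical in
/-- The integer indicator of an event at the configuration closed on `Z`. -/
noncomputable def ind (U : Set (Config E)) (Z : Finset E) : ℤ := if cfgOfClosed Z ∈ U then 1 else 0

omit [Fintype E] in
open Classical in
/-- `ind` is `{0,1}`-valued. -/
lemma ind_zero_one (U : Set (Config E)) (Z : Finset E) : ind U Z = 0 ∨ ind U Z = 1 := by
  unfold ind
  split_ifs <;> simp

omit [Fintype E] in
open Classical in
/-- For an increasing event, `ind` is antitone in the closed set. -/
lemma antitone_ind {U : Set (Config E)} (hU : IsUpperSet U) : Antitone (ind U) := by
  intro Z Z' h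
  unfold ind
  by_cases h' : cfgOfClosed Z' ∈ U
  · have : cfgOfClosed Z ∈ U := hU (cfgOfClosed_le_of_subset h) h'
    simp [h', this]
  · rw [if_neg h']
    split_ifs <;> norm_num

omit [Fintype E] in
open Classical in
/-- `ind` of the principal event: `1` exactly when `S` misses the closed set. -/
lemma ind_openOn (S Z : Finset E) : ind (openOn S) Z = if Disjoint S Z then 1 else 0 := by
  unfold ind
  have : cfgOfClosed Z ∈ openOn S ↔ Disjoint S Z := by
    rw [mem_openOn, disjoint_left]
    constructor
    · intro h x hx hxZ
      have := h x hx
      simp [cfgOfClosed_apply, hxZ] at this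
    · intro h x hx
      have := h hx
      simp [cfgOfClosed_apply, this]
  by_cases hd : Disjoint S Z
  · rw [if_pos (this.2 hd), if_pos hd]
  · rw [if_neg (fun hc => hd (this.1 hc)), if_neg hd]

open Classical in
/-- The real indicator of an event at a configuration is the cast of `ind` at its closed set. -/
lemma indicator_eq_ind {R : Type*} [CommRing R] (U : Set (Config E)) (ω : Config E) :
    U.indicator (fun _ => (1 : R)) ω = ((ind U (closedSet ω) : ℤ) : R) := by
  unfold ind
  rw [cfgOfClosed_closedSet]
  by_cases h : ω ∈ U
  · rw [Set.indicator_of_mem h, if_pos h]; simp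
  · rw [Set.indicator_of_notMem h, if_neg h]; simp

end Closed

section BaseCase

variable {E : Type*} [Fintype E] [DecidableEq E] {R : Type*} [Field R] [DecidableEq R]

/-- The edges pinned closed by `a` off `D`. -/
def pinnedClosed (a : E → R) (D : Finset E) : Finset E := univ.filter fun x => x ∉ D ∧ ¬ a x = 1

/-- The red set of a colouring `σ` of `D`: the edges of `D` closed in the first copy. -/
def redSet (D : Finset E) (σ : Config E) : Finset E := D.filter fun x => σ x = false

/-- The colouring of `D` with a prescribed red set: open on `D` exactly off `τ`, closed off `D`. -/
def colouring (D τ : Finset E) : Config E := fun x => decide (x ∈ D ∧ x ∉ τ)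

/-- Membership in `pinnedClosed`. -/
lemma mem_pinnedClosed {a : E → R} {D : Finset E} {x : E} :
    x ∈ pinnedClosed a D ↔ x ∉ D ∧ ¬ a x = 1 := by
  simp [pinnedClosed]

omit [Fintype E] [DecidableEq E] in
/-- Membership in `redSet`. -/
lemma mem_redSet {D : Finset E} {σ : Config E} {x : E} :
    x ∈ redSet D σ ↔ x ∈ D ∧ σ x = false := by
  simp [redSet]

/-- The closed set of the first copy at a base case: the red set and the pinned-closed edges. -/
lemma closedSet_baseConfig (a : E → R) (D : Finset E) (σ : Config E) :
    closedSet (baseConfig a D σ) = redSet D σ ∪ pinnedClosed a D := by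
  ext x
  simp only [mem_closedSet, mem_union, mem_redSet, mem_pinnedClosed, baseConfig]
  by_cases hx : x ∈ D
  · cases σ x <;> simp [hx]
  · simp [hx]

/-- The closed set of the second copy at a base case: the blue set and the pinned-closed edges. -/
lemma closedSet_baseConfig_not (a : E → R) (D : Finset E) (σ : Config E) :
    closedSet (baseConfig a D fun x => !σ x) = (D \ redSet D σ) ∪ pinnedClosed a D := by
  ext x
  simp only [mem_closedSet, mem_union, mem_sdiff, mem_redSet, mem_pinnedClosed, baseConfig]
  by_cases hx : x ∈ D
  · cases σ x <;> simp [hx]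
  · simp [hx]

/-- The summand of the antipodal base case at the red set `τ`, with the pinned-closed set `F`. -/
noncomputable def wt (S D F : Finset E) (U e : Set (Config E)) (τ : Finset E) : ℤ :=
  ind (openOn S) (τ ∪ F) * (ind U (τ ∪ F) - ind U ((D \ τ) ∪ F))
    * (ind e (τ ∪ F) - ind e ((D \ τ) ∪ F))

open Classical in
/-- The summand of `kform_eq_antipodal_sum` is the cast of `wt` at the red set. -/
lemma summand_eq_wt (a : E → R) (S D : Finset E) (U e : Set (Config E)) (σ : Config E) :
    (openOn S).indicator (fun _ => (1 : R)) (baseConfig a D σ)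
      * (U.indicator (fun _ => (1 : R)) (baseConfig a D σ)
          - U.indicator (fun _ => (1 : R)) (baseConfig a D fun x => !σ x))
      * (e.indicator (fun _ => (1 : R)) (baseConfig a D σ)
          - e.indicator (fun _ => (1 : R)) (baseConfig a D fun x => !σ x)) =
      ((wt S D (pinnedClosed a D) U e (redSet D σ) : ℤ) : R) := by
  rw [indicator_eq_ind, indicator_eq_ind, indicator_eq_ind, indicator_eq_ind, indicator_eq_ind,
    closedSet_baseConfig, closedSet_baseConfig_not]
  unfold wt
  push_cast
  ring

omit [Fintype E] [DecidableEq E] in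
/-- `redSet` maps the colourings supported on `D` into the subsets of `D`. -/
lemma redSet_mem_powerset (D : Finset E) (σ : Config E) : redSet D σ ∈ D.powerset :=
  mem_powerset.2 (filter_subset _ _)

/-- `colouring` maps the subsets of `D` into the colourings supported on `D`. -/
lemma colouring_mem_suppOn (D τ : Finset E) : colouring D τ ∈ suppOn D := by
  rw [mem_suppOn]
  intro x hx
  simp [colouring, hx]

/-- `colouring` inverts `redSet` on the colourings supported on `D`. -/
lemma colouring_redSet {D : Finset E} {σ : Config E} (hσ : σ ∈ suppOn D) :
    colouring D (redSet D σ) = σ := by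
  rw [mem_suppOn] at hσ
  funext x
  by_cases hx : x ∈ D
  · cases hσx : σ x <;> simp [colouring, redSet, hx, hσx]
  · simp [colouring, hx, hσ x hx]

omit [Fintype E] in
/-- `redSet` inverts `colouring` on the subsets of `D`. -/
lemma redSet_colouring {D τ : Finset E} (hτ : τ ∈ D.powerset) :
    redSet D (colouring D τ) = τ := by
  rw [mem_powerset] at hτ
  ext x
  simp only [mem_redSet, colouring]
  constructor
  · rintro ⟨hxD, hx⟩
    by_contra hxτ
    simp [hxD, hxτ] at hx
  · intro hx
    exact ⟨hτ hx, by simp [hτ hx, hx]⟩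

omit [Fintype E] [DecidableEq R] in
/-- When `S` meets the pinned-closed set, every summand vanishes. -/
lemma wt_eq_zero_of_not_disjoint {S D F : Finset E} (U e : Set (Config E)) (hSF : ¬ Disjoint S F)
    (τ : Finset E) : wt S D F U e τ = 0 := by
  unfold wt
  rw [ind_openOn, if_neg]
  · simp
  · intro hd
    exact hSF (hd.mono_right subset_union_right)

omit [Fintype E] [DecidableEq R] in
/-- When `S` misses the pinned-closed set, the summand at a red set meeting `S` vanishes. -/
lemma wt_eq_zero_of_not_disjoint_red {S D F : Finset E} (U e : Set (Config E)) {τ : Finset E}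
    (hτ : ¬ Disjoint S τ) : wt S D F U e τ = 0 := by
  unfold wt
  rw [ind_openOn, if_neg]
  · simp
  · intro hd
    exact hτ (hd.mono_right subset_union_left)

omit [Fintype E] [DecidableEq R] in
/-- When `S` misses both the pinned-closed set and the red set, the summand is the Kleitman term
with the pinned sets `F ⊆ F ∪ (D ∩ S)` over `D ∖ S`. -/
lemma wt_eq_of_disjoint {S D F : Finset E} (U e : Set (Config E)) (hSF : Disjoint S F)
    {τ : Finset E} (hτ : Disjoint S τ) :
    wt S D F U e τ =
      (ind U (τ ∪ F) - ind U (((D \ S) \ τ) ∪ (F ∪ (D ∩ S))))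
        * (ind e (τ ∪ F) - ind e (((D \ S) \ τ) ∪ (F ∪ (D ∩ S)))) := by
  unfold wt
  rw [ind_openOn, if_pos (Finset.disjoint_union_right.2 ⟨hτ, hSF⟩)]
  have hset : (D \ τ) ∪ F = ((D \ S) \ τ) ∪ (F ∪ (D ∩ S)) := by
    ext x
    simp only [mem_union, mem_sdiff, mem_inter]
    constructor
    · rintro (⟨hxD, hxτ⟩ | hxF)
      · by_cases hxS : x ∈ S
        · exact Or.inr (Or.inr ⟨hxD, hxS⟩)
        · exact Or.inl ⟨⟨hxD, hxS⟩, hxτ⟩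
      · exact Or.inr (Or.inl hxF)
    · rintro (⟨⟨hxD, _⟩, hxτ⟩ | hxF | ⟨hxD, hxS⟩)
      · exact Or.inl ⟨hxD, hxτ⟩
      · exact Or.inr hxF
      · exact Or.inl ⟨hxD, fun hxτ => Finset.disjoint_left.1 hτ hxS hxτ⟩
  rw [hset]
  ring

omit [Fintype E] [DecidableEq R] in
/-- **Every antipodal base case of a principal edge event is nonnegative.** -/
theorem sum_wt_nonneg {U e : Set (Config E)} (hU : IsUpperSet U) (he : IsUpperSet e)
    (S D F : Finset E) : 0 ≤ ∑ τ ∈ D.powerset, wt S D F U e τ := by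
  by_cases hSF : Disjoint S F
  · -- restrict the sum to the red sets missing `S`
    have hsplit : ∑ τ ∈ D.powerset, wt S D F U e τ =
        ∑ τ ∈ (D \ S).powerset, wt S D F U e τ := by
      rw [← sum_filter_add_sum_filter_not D.powerset (fun τ => Disjoint S τ)]
      have hz : ∑ τ ∈ D.powerset.filter (fun τ => ¬ Disjoint S τ), wt S D F U e τ = 0 :=
        sum_eq_zero fun τ hτ => wt_eq_zero_of_not_disjoint_red U e (mem_filter.1 hτ).2
      rw [hz, add_zero]
      refine sum_congr ?_ fun _ _ => rfl
      ext τ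
      simp only [mem_filter, mem_powerset, subset_sdiff]
      rw [disjoint_comm]
    rw [hsplit]
    have hterm : ∀ τ ∈ (D \ S).powerset, wt S D F U e τ =
        (ind U (τ ∪ F) - ind U (((D \ S) \ τ) ∪ (F ∪ (D ∩ S))))
          * (ind e (τ ∪ F) - ind e (((D \ S) \ τ) ∪ (F ∪ (D ∩ S)))) := by
      intro τ hτ
      rw [mem_powerset, subset_sdiff] at hτ
      exact wt_eq_of_disjoint U e hSF hτ.2.symm
    rw [sum_congr rfl hterm]
    exact antipodal_comparable_nonneg (D \ S) F (F ∪ (D ∩ S)) (ind U) (ind e) subset_union_left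
      (ind_zero_one U) (antitone_ind hU) (ind_zero_one e) (antitone_ind he)
  · rw [sum_eq_zero fun τ _ => wt_eq_zero_of_not_disjoint U e hSF τ]

end BaseCase

section Main

variable {E : Type*} [Fintype E] [DecidableEq E] {R : Type*} [Field R] [LinearOrder R]
  [IsStrictOrderedRing R]

/-- Every antipodal base case of the principal edge event is nonnegative (the hypothesis of the
reduction theorem). -/
theorem kform_nonneg (S : Finset E) {U e : Set (Config E)} (hU : IsUpperSet U)
    (he : IsUpperSet e) (D : Finset E) (a : E → R) (ha : ∀ x, x ∉ D → a x = 0 ∨ a x = 1) :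
    0 ≤ kform (openOn S) U e D a := by
  classical
  rw [kform_eq_antipodal_sum _ _ _ ha]
  rw [sum_congr rfl fun σ _ => summand_eq_wt a S D U e σ]
  have hre : ∑ σ ∈ suppOn D, ((wt S D (pinnedClosed a D) U e (redSet D σ) : ℤ) : R) =
      ((∑ τ ∈ D.powerset, wt S D (pinnedClosed a D) U e τ : ℤ) : R) := by
    rw [Int.cast_sum]
    exact sum_nbij' (redSet D) (colouring D) (fun σ _ => redSet_mem_powerset D σ)
      (fun τ _ => colouring_mem_suppOn D τ) (fun σ hσ => colouring_redSet hσ)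
      (fun τ hτ => redSet_colouring hτ) (fun _ _ => rfl)
  rw [hre]
  exact Int.cast_nonneg (sum_wt_nonneg hU he S D (pinnedClosed a D))

/-- **(T) for a principal edge event**: for admissible weights, a finite set `S` of edges and
increasing events `U e`, with `Q = {every edge of S is open}`,
`P(Q ∩ U) P(e) + P(Q ∩ e) P(U) ≤ P(Q ∩ U ∩ e) + P(Q) P(U ∩ e)`. -/
theorem t_principal (p : E → R) (hp : IsProbVec p) (S : Finset E) {U e : Set (Config E)}
    (hU : IsUpperSet U) (he : IsUpperSet e) :
    prob p (openOn S ∩ U) * prob p e + prob p (openOn S ∩ e) * prob p U ≤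
      prob p (openOn S ∩ U ∩ e) + prob p (openOn S) * prob p (U ∩ e) :=
  tform_nonneg_of_base (openOn S) U e (fun D a _ ha => kform_nonneg S hU he D a ha) p hp

/-- **(T) for a principal edge event against cluster events**: on any graph `ends`, for the
root `s`, up-sets `𝓤 𝓥` of vertex sets and a finite edge set `S`, with `Q = {S open}`,
`U = {C(s) ∈ 𝓤}`, `e = {C(s) ∈ 𝓥}`. -/
theorem t_principal_cluster {V : Type*} (p : E → R) (hp : IsProbVec p) (ends : E → Sym2 V)
    (s : V) (S : Finset E) {𝓤 𝓥 : Set (Set V)} (hU : IsUpperSet 𝓤) (hV : IsUpperSet 𝓥) :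
    prob p (openOn S ∩ clusterInEvent ends s 𝓤) * prob p (clusterInEvent ends s 𝓥)
        + prob p (openOn S ∩ clusterInEvent ends s 𝓥) * prob p (clusterInEvent ends s 𝓤) ≤
      prob p (openOn S ∩ clusterInEvent ends s 𝓤 ∩ clusterInEvent ends s 𝓥)
        + prob p (openOn S) * prob p (clusterInEvent ends s 𝓤 ∩ clusterInEvent ends s 𝓥) :=
  t_principal p hp S (isUpperSet_clusterInEvent ends s hU) (isUpperSet_clusterInEvent ends s hV)

end Main

end TPrincipal

end Summit.Ventures.PercRepro2
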